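import Literature.NumberTheory.LFunctions.WeilExplicit
import Literature.NumberTheory.LFunctions.WeilArchimedeanMoments
import Literature.NumberTheory.LFunctions.WeilArchimedeanPositivityProofs
import Literature.NumberTheory.LFunctions.RiemannSiegelStirling
import Literature.Analysis.SpecialFunctions.DigammaVerticalSeries
import Mathlib.MeasureTheory.Integral.IntervalIntegral.FundThmCalculus
import Mathlib.Analysis.SpecialFunctions.Log.Deriv

/-!
# Stub `stub_archBathtub` (crux `WeilComb.CombShapePositivity`, stmt-RiemannHypothesis-11229, line `Sketch`)
# — siege k2: explicit monotone comparison of the archimedean term, Steffensen form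

For a Weil test `g` with `L = ‖g‖₁` (`weilNorm1`), `N = ‖g‖₂²` (`weilNorm2Sq`), `0 < L` and `2L² ≤ πN`:

`N (log(N/(2L²)) − 1) − (21/(5π)) L² ≤ Re W_∞(g ⋆ g̃)`.

The proof is organised around ONE abstract monotone-comparison inequality and three explicit
comparisons of the archimedean weight `ρ(u) = Re ψ(1/4 + iu/2)` (`reDigammaQuarter`):

1. **Monotone comparison at a level** (`level_comparison_of_monotone`, the whole-line form of
   Steffensen's inequality): for ANY continuous weight `w` increasing in `|u|`, any `0 ≤ G ≤ c` with `G` and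
   `G w` integrable, and any level `T ≥ 0`,
   `c ∫_{−T}^{T} w + w(T) (∫ G − 2Tc) ≤ ∫ G w`
   — pointwise `1_{(−T,T]} c (w − w(T)) + w(T) G ≤ G w`, since `w − w(T)` has the sign of `|u| − T`.
2. Applied to `G(u) = |ĝ(1/2+iu)|²`, `c = L²` (`norm_weilMellin_half_line_le`), `∫ G = 2πN` (Plancherel,
   `integral_norm_sq_weilMellin_half_line`) and `w = ρ` (`reDigammaQuarter_mono`), together with
   `Re W_∞(g ⋆ g̃) = (1/2π) ∫ G ρ − N log π` (`weilArchIntegral_weilConv_weilReflect`), this is the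
   **level comparison for the archimedean term** (`arch_level_comparison`), valid at every level `T ≥ 0`;
   at the bathtub level `T = πN/L²` the correction `ρ(T)(2πN − 2TL²)` vanishes.
3. The weight against explicit functions, using only its monotonicity and two certified inputs of the tree:
   * nodes (`reDigammaQuarter_ge_node`): `ρ(a) ≥ ψ(¼) + 4 − 4/(1 + 4a²)` (first term of Yoshida's vertical
     series, `sum_digammaTerm_le`, with `ψ(¼) ≥ −4.22745354`, `re_digamma_one_quarter_ge`), and the monotone
     staircase `[0,½] ∪ [½,1] ∪ [1,2]` (`step_le_integral_of_monotone`): `∫_0^2 ρ ≥ −43/10`;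
   * tail (`log_sub_le_reDigammaQuarter`): `ρ(t) ≥ log(t/2) − 4K(¼)/t²` for `t ≥ 2`, the tree's vertical
     Stirling bound `|Re ψ(¼ + iu) − log u| ≤ K(¼)/u²` (`abs_re_digamma_vertical_sub_log_le`, `u = t/2 ≥ 1`,
     `K(¼) = stirlingVertRate ¼ = 1/6 + π/12 + 5/32 ≤ 2/3`), integrated by the fundamental theorem of calculus
     in inequality form with the primitive `u log(u/2) − u + 4K(¼)/u`:
     `∫_2^T ρ ≥ T log(T/2) − T + 2 − 2K(¼)`.
   Hence `∫_{−T}^{T} ρ ≥ 2T (log(T/2) − 1) − 8` for `T ≥ 2` (`integral_reDigammaQuarter_symm_ge`; the stub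
   only needs `42/5`).
4. Assembly (`stub_archBathtub`): at `T = πN/L² ≥ 2`, `(1/2π) L² (2T(log(T/2) − 1) − 8) − N log π
   = N (log(N/(2L²)) − 1) − (4/π) L² ≥ N (log(N/(2L²)) − 1) − (21/(5π)) L²`.

Design: the comparison step is stated for an arbitrary weight/majorant pair, so that it does not depend on
the Weil dictionary; the digamma tail uses the one-term rate `K(¼)/u²` rather than the three-term
second-order bound or the `arg Γ`–Stirling formula. The file lives in the sub-namespace
`…WeilCombBohrFejer.ArchSteffensen`, so `stub_archBathtub` keeps its registered short name and signature.
-/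

noncomputable section

-- the sub-problem path RiemannHypothesis/RiemannHypothesis duplicates a namespace (D-0017)
set_option linter.dupNamespace false

open Complex MeasureTheory Set

namespace Summit.RiemannHypothesis.RiemannHypothesis.Theorems.WeilCombBohrFejer.ArchSteffensen

open Literature.NumberTheory.LFunctions
open Literature.Analysis.SpecialFunctions (reDigammaQuarter reDigammaQuarter_even reDigammaQuarter_mono
  continuous_reDigammaQuarter reDigammaQuarter_zero sum_digammaTerm_le re_digamma_one_quarter_ge
  digammaTerm digammaNode digammaTerm_eq digammaNode_pos)

/-! ### 1. Monotone comparison at a level (Steffensen's inequality on the line) -/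

/-- **Monotone comparison at a level** (whole-line form of Steffensen's inequality, 1918). Let `w` be a
continuous weight, increasing in `|u|`, and `G` a majorised density: `0 ≤ G ≤ c`, `G` and `G·w` integrable.
Then for every level `T ≥ 0`:
`c ∫_{−T}^{T} w + w(T) (∫ G − 2Tc) ≤ ∫ G w`.
Pointwise, `1_{(−T,T]}(u) c (w(u) − w(T)) + w(T) G(u) ≤ G(u) w(u)`: for `|u| ≤ T` the difference is
`(c − G(u))(w(T) − w(u)) ≥ 0`, for `|u| ≥ T` it is `G(u)(w(u) − w(T)) ≥ 0`. [folklore] -/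
theorem level_comparison_of_monotone {w G : ℝ → ℝ} {c T : ℝ} (hwc : Continuous w)
    (hw : ∀ ⦃u t : ℝ⦄, |u| ≤ |t| → w u ≤ w t) (hG0 : ∀ u, 0 ≤ G u) (hGc : ∀ u, G u ≤ c)
    (hGi : Integrable G) (hGwi : Integrable fun u ↦ G u * w u) (hT : 0 ≤ T) :
    c * (∫ u in (-T)..T, w u) + w T * ((∫ u, G u) - 2 * T * c) ≤ ∫ u, G u * w u := by
  have hTT : -T ≤ T := by linarith
  -- the concentrated part `k = 1_{(−T,T]} c (w − w(T))` and the comparison function `k + w(T) G`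
  set k : ℝ → ℝ := (Ioc (-T) T).indicator (fun u ↦ c * (w u - w T)) with hk
  have hki : Integrable k :=
    ((continuous_const.mul (hwc.sub continuous_const)).intervalIntegrable (-T) T).1.integrable_indicator
      measurableSet_Ioc
  have hkval : ∫ u, k u = c * ((∫ u in (-T)..T, w u) - 2 * T * w T) := by
    rw [hk, integral_indicator measurableSet_Ioc, ← intervalIntegral.integral_of_le hTT,
      intervalIntegral.integral_const_mul, intervalIntegral.integral_sub (hwc.intervalIntegrable _ _)
        intervalIntegrable_const, intervalIntegral.integral_const, smul_eq_mul]
    ring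
  have hhi : Integrable fun u ↦ k u + w T * G u := hki.add (hGi.const_mul _)
  have hhval : ∫ u, (k u + w T * G u) = c * (∫ u in (-T)..T, w u) + w T * ((∫ u, G u) - 2 * T * c) := by
    rw [integral_add hki (hGi.const_mul _), integral_const_mul, hkval]
    ring
  -- pointwise comparison
  have hpt : ∀ u, k u + w T * G u ≤ G u * w u := by
    intro u
    by_cases hu : u ∈ Ioc (-T) T
    · have hku : k u = c * (w u - w T) := by rw [hk]; exact indicator_of_mem hu _
      have hwu : w u ≤ w T := hw (abs_le_abs hu.2 (by linarith [hu.1]))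
      have hprod : 0 ≤ (c - G u) * (w T - w u) :=
        mul_nonneg (sub_nonneg.2 (hGc u)) (sub_nonneg.2 hwu)
      rw [hku]
      nlinarith [hprod]
    · have hku : k u = 0 := by rw [hk]; exact indicator_of_notMem hu _
      have hTu : |T| ≤ |u| := by
        rw [abs_of_nonneg hT]
        simp only [mem_Ioc, not_and_or, not_lt, not_le] at hu
        rcases hu with h1 | h1
        · linarith [neg_abs_le u]
        · linarith [le_abs_self u]
      rw [hku, zero_add, mul_comm (G u)]
      exact mul_le_mul_of_nonneg_right (hw hTu) (hG0 u)
  have hmono := integral_mono hhi hGwi hpt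
  rwa [hhval] at hmono

/-- One monotone step of a weight increasing in `|u|`: for `0 ≤ a ≤ b`, `(b − a) w(a) ≤ ∫_a^b w`. [folklore] -/
theorem step_le_integral_of_monotone {w : ℝ → ℝ} (hwc : Continuous w)
    (hw : ∀ ⦃u t : ℝ⦄, |u| ≤ |t| → w u ≤ w t) {a b : ℝ} (ha : 0 ≤ a) (hab : a ≤ b) :
    (b - a) * w a ≤ ∫ u in a..b, w u := by
  have h := intervalIntegral.integral_mono_on hab (intervalIntegrable_const (μ := volume))
    (hwc.intervalIntegrable a b)
    (fun u hu ↦ hw (by rw [abs_of_nonneg ha, abs_of_nonneg (ha.trans hu.1)]; exact hu.1))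
  rwa [intervalIntegral.integral_const, smul_eq_mul] at h

/-! ### 2. The archimedean term of an autocorrelation: level comparison -/

/-- **Level comparison for the archimedean term.** For a Weil test `g` and EVERY level `T ≥ 0`:
`(1/2π) (‖g‖₁² ∫_{−T}^{T} ρ + ρ(T) (2π‖g‖₂² − 2T‖g‖₁²)) − ‖g‖₂² log π ≤ Re W_∞(g ⋆ g̃)`:
`Re W_∞(g ⋆ g̃) = (1/2π) ∫ |ĝ(1/2+iu)|² ρ(u) du − ‖g‖₂² log π` (`weilArchIntegral_weilConv_weilReflect`,
`weilConv_weilReflect_apply_zero`), then `level_comparison_of_monotone` with `w = ρ`, `G = |ĝ(1/2+i·)|²`,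
`c = ‖g‖₁²` (`norm_weilMellin_half_line_le`) and `∫ G = 2π‖g‖₂²` (`integral_norm_sq_weilMellin_half_line`).
At the bathtub level `T = π‖g‖₂²/‖g‖₁²` the correction term vanishes. [folklore] -/
theorem arch_level_comparison {g : ℝ → ℂ} (hg : IsWeilTest g) {T : ℝ} (hT : 0 ≤ T) :
    1 / (2 * Real.pi) * (weilNorm1 g ^ 2 * (∫ u in (-T)..T, reDigammaQuarter u) +
        reDigammaQuarter T * (2 * Real.pi * weilNorm2Sq g - 2 * T * weilNorm1 g ^ 2)) -
      weilNorm2Sq g * Real.log Real.pi ≤ (weilArchTerm (weilConv g (weilReflect g))).re := by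
  -- the archimedean term of the autocorrelation as a real number
  have hA : (∫ t : ℝ, ‖weilMellin g (1 / 2 + t * I)‖ ^ 2 * (Complex.digamma (1 / 4 + t / 2 * I)).re) =
      ∫ u : ℝ, ‖weilMellin g (1 / 2 + u * I)‖ ^ 2 * reDigammaQuarter u :=
    rfl
  have harch : (weilArchTerm (weilConv g (weilReflect g))).re =
      1 / (2 * Real.pi) * (∫ u : ℝ, ‖weilMellin g (1 / 2 + u * I)‖ ^ 2 * reDigammaQuarter u) -
        weilNorm2Sq g * Real.log Real.pi := by
    have e : weilArchTerm (weilConv g (weilReflect g)) =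
        ((1 / (2 * Real.pi) * (∫ u : ℝ, ‖weilMellin g (1 / 2 + u * I)‖ ^ 2 * reDigammaQuarter u) -
          weilNorm2Sq g * Real.log Real.pi : ℝ) : ℂ) := by
      unfold weilArchTerm weilNorm2Sq
      rw [weilArchIntegral_weilConv_weilReflect hg, weilConv_weilReflect_apply_zero, hA]
      push_cast
      ring
    rw [e, Complex.ofReal_re]
  rw [harch]
  -- the monotone comparison at the level `T`
  have h := level_comparison_of_monotone (w := reDigammaQuarter)
    (G := fun u ↦ ‖weilMellin g (1 / 2 + u * I)‖ ^ 2) (c := weilNorm1 g ^ 2) (T := T)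
    continuous_reDigammaQuarter (fun u t hut ↦ reDigammaQuarter_mono hut) (fun u ↦ by positivity)
    (fun u ↦ pow_le_pow_left₀ (norm_nonneg _) (norm_weilMellin_half_line_le hg u) 2)
    (integrable_norm_sq_weilMellin_half_line hg) (integrable_norm_sq_weilMellin_mul_reDigammaQuarter hg) hT
  rw [integral_norm_sq_weilMellin_half_line hg] at h
  have hπ : (0 : ℝ) ≤ 1 / (2 * Real.pi) := by positivity
  have h' := mul_le_mul_of_nonneg_left h hπ
  linarith [h']

/-! ### 3. Explicit comparisons for the weight `ρ(u) = Re ψ(1/4 + iu/2)` -/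

/-- **Node bound** (first term of Yoshida's vertical series): `ψ(¼) + 4 − 4/(1 + 4a²) ≤ ρ(a)` with
`ψ(¼) ≥ −4.22745354` (`sum_digammaTerm_le`, `digammaTerm_eq` at `l₀ = ½`, `re_digamma_one_quarter_ge`). [folklore] -/
theorem reDigammaQuarter_ge_node (a : ℝ) :
    -0.22745354 - 4 / (1 + 4 * a ^ 2) ≤ reDigammaQuarter a := by
  have h := sum_digammaTerm_le 1 a
  rw [Finset.sum_range_one] at h
  have h0 : (-4.22745354 : ℝ) ≤ reDigammaQuarter 0 := by
    rw [reDigammaQuarter_zero]; exact re_digamma_one_quarter_ge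
  have hl : digammaNode 0 = 1 / 2 := by simp [digammaNode]
  have ht : digammaTerm (digammaNode 0) a = 4 - 4 / (1 + 4 * a ^ 2) := by
    rw [digammaTerm_eq (digammaNode_pos 0), hl]
    have h1 : (0 : ℝ) < 1 + 4 * a ^ 2 := by positivity
    have h2 : (0 : ℝ) < (1 / 2) ^ 2 + a ^ 2 := by positivity
    field_simp
    ring
  linarith

/-- **Monotone staircase on `[0, 2]`:** `∫_0^2 ρ ≥ −43/10`, from the three steps `[0,½]`, `[½,1]`, `[1,2]`
with the node bounds `ρ(0) ≥ −4.2275`, `ρ(½) ≥ −2.2275`, `ρ(1) ≥ −1.0275` (value `≥ −4.255`). [folklore] -/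
theorem integral_reDigammaQuarter_zero_two_ge :
    -(43 / 10 : ℝ) ≤ ∫ u in (0 : ℝ)..2, reDigammaQuarter u := by
  have hc : Continuous reDigammaQuarter := continuous_reDigammaQuarter
  have hm : ∀ ⦃u t : ℝ⦄, |u| ≤ |t| → reDigammaQuarter u ≤ reDigammaQuarter t :=
    fun u t hut ↦ reDigammaQuarter_mono hut
  have s1 := step_le_integral_of_monotone hc hm (a := 0) (b := 1 / 2) le_rfl (by norm_num)
  have s2 := step_le_integral_of_monotone hc hm (a := 1 / 2) (b := 1) (by norm_num) (by norm_num)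
  have s3 := step_le_integral_of_monotone hc hm (a := 1) (b := 2) (by norm_num) (by norm_num)
  have v1 := reDigammaQuarter_ge_node 0
  have v2 := reDigammaQuarter_ge_node (1 / 2)
  have v3 := reDigammaQuarter_ge_node 1
  norm_num at v1 v2 v3
  have e : ∫ u in (0 : ℝ)..2, reDigammaQuarter u =
      (∫ u in (0 : ℝ)..(1 / 2), reDigammaQuarter u) + (∫ u in (1 / 2 : ℝ)..1, reDigammaQuarter u) +
        ∫ u in (1 : ℝ)..2, reDigammaQuarter u := by
    rw [intervalIntegral.integral_add_adjacent_intervals (hc.intervalIntegrable _ _) (hc.intervalIntegrable _ _),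
      intervalIntegral.integral_add_adjacent_intervals (hc.intervalIntegrable _ _) (hc.intervalIntegrable _ _)]
  rw [e]
  linarith

/-- **Tail comparison, pointwise.** For `t ≥ 2`: `log(t/2) − 4K(¼)/t² ≤ ρ(t)`, the vertical Stirling bound
`|Re ψ(¼ + iu) − log u| ≤ K(¼)/u²` (`abs_re_digamma_vertical_sub_log_le`) at `u = t/2 ≥ 1`. [folklore] -/
theorem log_sub_le_reDigammaQuarter {t : ℝ} (ht : 2 ≤ t) :
    Real.log (t / 2) - 4 * stirlingVertRate (1 / 4) / t ^ 2 ≤ reDigammaQuarter t := by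
  have hu : (1 : ℝ) ≤ t / 2 := by linarith
  have ht0 : 0 < t := by linarith
  have h := abs_re_digamma_vertical_sub_log_le (σ := 1 / 4) (u := t / 2) (by norm_num) hu
  have e : (((1 / 4 : ℝ) : ℂ) + ((t / 2 : ℝ) : ℂ) * I) = 1 / 4 + (t : ℂ) / 2 * I := by
    push_cast
    ring
  have hρ : (Complex.digamma (((1 / 4 : ℝ) : ℂ) + ((t / 2 : ℝ) : ℂ) * I)).re = reDigammaQuarter t := by
    rw [e]
    rfl
  rw [hρ] at h
  have h' := (abs_le.1 h).1
  have e2 : stirlingVertRate (1 / 4) / (t / 2) ^ 2 = 4 * stirlingVertRate (1 / 4) / t ^ 2 := by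
    field_simp
    ring
  linarith [e2]

/-- **Tail comparison, integrated.** For `T ≥ 2`: `T log(T/2) − T + 2 − 2K(¼) ≤ ∫_2^T ρ`, by the fundamental
theorem of calculus in inequality form (`intervalIntegral.sub_le_integral_of_hasDeriv_right_of_le`) for the
primitive `F(u) = u log(u/2) − u + 4K(¼)/u` of the pointwise minorant, with `F(T) ≥ T log(T/2) − T` and
`F(2) = −2 + 2K(¼)`. [folklore] -/
theorem integral_reDigammaQuarter_two_ge {T : ℝ} (hT : 2 ≤ T) :
    T * Real.log (T / 2) - T + 2 - 2 * stirlingVertRate (1 / 4) ≤ ∫ u in (2 : ℝ)..T, reDigammaQuarter u := by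
  set K : ℝ := stirlingVertRate (1 / 4) with hK
  have hK0 : 0 ≤ K := by
    rw [hK, stirlingVertRate]
    positivity
  set F : ℝ → ℝ := fun u ↦ u * Real.log (u / 2) - u + 4 * K * u⁻¹ with hF
  set f : ℝ → ℝ := fun u ↦ Real.log (u / 2) - 4 * K * (u ^ 2)⁻¹ with hf
  -- `F' = f` on `(0, ∞)`
  have hderiv : ∀ u : ℝ, 0 < u → HasDerivAt F (f u) u := by
    intro u hu
    have hu0 : u ≠ 0 := hu.ne'
    have h1 : HasDerivAt (fun x : ℝ ↦ Real.log (x / 2)) ((1 / 2) / (u / 2)) u :=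
      ((hasDerivAt_id' u).div_const 2).log (by positivity)
    have h2 : HasDerivAt (fun x : ℝ ↦ x * Real.log (x / 2))
        (1 * Real.log (u / 2) + u * ((1 / 2) / (u / 2))) u :=
      (hasDerivAt_id' u).mul h1
    have h3 : HasDerivAt (fun x : ℝ ↦ 4 * K * x⁻¹) (4 * K * (-(u ^ 2)⁻¹)) u :=
      (hasDerivAt_inv hu0).const_mul (4 * K)
    have h4 := (h2.sub (hasDerivAt_id' u)).add h3
    have e : 1 * Real.log (u / 2) + u * ((1 / 2) / (u / 2)) - 1 + 4 * K * (-(u ^ 2)⁻¹) = f u := by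
      simp only [hf]
      field_simp
      ring
    rw [e] at h4
    exact h4
  have hcont : ContinuousOn F (Icc 2 T) := fun x hx ↦
    (hderiv x (by linarith [hx.1])).continuousAt.continuousWithinAt
  have hderiv' : ∀ x ∈ Ioo 2 T, HasDerivWithinAt F (f x) (Ioi x) x := fun x hx ↦
    (hderiv x (by linarith [hx.1])).hasDerivWithinAt
  have hint : IntegrableOn reDigammaQuarter (Icc 2 T) := continuous_reDigammaQuarter.integrableOn_Icc
  have hle : ∀ x ∈ Ioo 2 T, f x ≤ reDigammaQuarter x := fun x hx ↦ by
    have h := log_sub_le_reDigammaQuarter (t := x) (le_of_lt hx.1)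
    have e : f x = Real.log (x / 2) - 4 * K / x ^ 2 := by
      simp only [hf]
      ring
    rw [e]
    exact h
  have key := intervalIntegral.sub_le_integral_of_hasDeriv_right_of_le hT hcont hderiv' hint hle
  -- the end values
  have hT0 : 0 < T := by linarith
  have hFT : T * Real.log (T / 2) - T ≤ F T := by
    have h1 : 0 ≤ 4 * K * T⁻¹ := by positivity
    simp only [hF]
    linarith
  have hF2 : F 2 = -2 + 2 * K := by
    simp only [hF]
    rw [show (2 : ℝ) / 2 = 1 by norm_num, Real.log_one]
    ring
  linarith

/-- **The symmetric integral.** For `T ≥ 2`: `2T (log(T/2) − 1) − 8 ≤ ∫_{−T}^{T} ρ` (evenness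
`reDigammaQuarter_even`, the staircase on `[0,2]`, the tail on `[2,T]`, and `K(¼) ≤ 2/3` from `π ≤ 4`;
the value is `≥ … − 7.27`, the stub needs `42/5`). [folklore] -/
theorem integral_reDigammaQuarter_symm_ge {T : ℝ} (hT : 2 ≤ T) :
    2 * T * (Real.log (T / 2) - 1) - 8 ≤ ∫ u in (-T)..T, reDigammaQuarter u := by
  have hc : Continuous reDigammaQuarter := continuous_reDigammaQuarter
  have h1 : ∫ u in (-T)..0, reDigammaQuarter u = ∫ u in (0 : ℝ)..T, reDigammaQuarter u := by
    have h := intervalIntegral.integral_comp_neg reDigammaQuarter (a := 0) (b := T)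
    simp only [neg_zero, reDigammaQuarter_even] at h
    exact h.symm
  have h2 : (∫ u in (0 : ℝ)..2, reDigammaQuarter u) + (∫ u in (2 : ℝ)..T, reDigammaQuarter u) =
      ∫ u in (0 : ℝ)..T, reDigammaQuarter u :=
    intervalIntegral.integral_add_adjacent_intervals (hc.intervalIntegrable 0 2) (hc.intervalIntegrable 2 T)
  rw [← intervalIntegral.integral_add_adjacent_intervals (hc.intervalIntegrable (-T) 0)
    (hc.intervalIntegrable 0 T), h1, ← h2]
  have hA := integral_reDigammaQuarter_zero_two_ge
  have hB := integral_reDigammaQuarter_two_ge hT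
  have hK : stirlingVertRate (1 / 4) ≤ 2 / 3 := by
    rw [stirlingVertRate]
    have hπ := Real.pi_le_four
    nlinarith
  linarith

/-! ### 4. The stub -/

/-- **Stub S3 — bathtub bound for the archimedean diagonal of a Weil test** (explicit monotone comparison,
Steffensen form). For a Weil test `g` with `0 < ‖g‖₁` and `2‖g‖₁² ≤ π‖g‖₂²`:
`‖g‖₂² (log(‖g‖₂²/(2‖g‖₁²)) − 1) − (21/(5π)) ‖g‖₁² ≤ Re W_∞(g ⋆ g̃)`.
Proof: `arch_level_comparison` at the bathtub level `T = π‖g‖₂²/‖g‖₁² ≥ 2` (where it reads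
`(1/2π) ‖g‖₁² ∫_{−T}^{T} ρ − ‖g‖₂² log π ≤ Re W_∞(g ⋆ g̃)`), `integral_reDigammaQuarter_symm_ge`, and the
identity `(1/2π) ‖g‖₁² (2T(log(T/2) − 1) − 8) − ‖g‖₂² log π = ‖g‖₂² (log(‖g‖₂²/(2‖g‖₁²)) − 1) − (4/π)‖g‖₁²`
(`‖g‖₁² T = π‖g‖₂²`), with `4/π ≤ 21/(5π)`. -/
theorem stub_archBathtub : ∀ g : ℝ → ℂ, IsWeilTest g → 0 < weilNorm1 g →
    2 * weilNorm1 g ^ 2 ≤ Real.pi * weilNorm2Sq g →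
    weilNorm2Sq g * (Real.log (weilNorm2Sq g / (2 * weilNorm1 g ^ 2)) - 1) -
        21 / (5 * Real.pi) * weilNorm1 g ^ 2 ≤
      (weilArchTerm (weilConv g (weilReflect g))).re := by
  intro g hg hL hcond
  set N := weilNorm2Sq g with hN
  set L := weilNorm1 g with hL'
  have hπ : 0 < Real.pi := Real.pi_pos
  have hπ0 : Real.pi ≠ 0 := hπ.ne'
  have hL2 : 0 < L ^ 2 := by positivity
  have hN0 : 0 < N := pos_of_mul_pos_right (by linarith : 0 < Real.pi * N) hπ.le
  set T : ℝ := Real.pi * N / L ^ 2 with hT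
  have hLT : L ^ 2 * T = Real.pi * N := by
    rw [hT]
    field_simp
  have hT2 : 2 ≤ T := by
    rw [hT, le_div_iff₀ hL2]
    linarith
  -- Step 1: the level comparison at the bathtub level (the correction term vanishes)
  have hlev := arch_level_comparison hg (T := T) (by linarith)
  rw [← hN, ← hL'] at hlev
  have hcorr : 2 * Real.pi * N - 2 * T * L ^ 2 = 0 := by
    have e : 2 * T * L ^ 2 = 2 * (L ^ 2 * T) := by ring
    rw [e, hLT]
    ring
  rw [hcorr, mul_zero, add_zero] at hlev
  -- Step 2: the symmetric digamma integral
  have hstir := integral_reDigammaQuarter_symm_ge hT2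
  have hmono : 1 / (2 * Real.pi) * (L ^ 2 * (2 * T * (Real.log (T / 2) - 1) - 8)) ≤
      1 / (2 * Real.pi) * (L ^ 2 * ∫ u in (-T)..T, reDigammaQuarter u) :=
    mul_le_mul_of_nonneg_left (mul_le_mul_of_nonneg_left hstir hL2.le) (by positivity)
  -- Step 3: the algebra `L² T = π N`
  have hq : 0 < N / (2 * L ^ 2) := by positivity
  have hlog : Real.log (T / 2) = Real.log Real.pi + Real.log (N / (2 * L ^ 2)) := by
    rw [← Real.log_mul hπ0 hq.ne']
    congr 1
    rw [hT]
    field_simp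
  have key : 1 / (2 * Real.pi) * (L ^ 2 * (2 * T * (Real.log (T / 2) - 1) - 8)) =
      N * (Real.log (N / (2 * L ^ 2)) - 1) + N * Real.log Real.pi - 4 / Real.pi * L ^ 2 := by
    have e : L ^ 2 * (2 * T * (Real.log (T / 2) - 1) - 8) =
        2 * (Real.pi * N) * (Real.log (T / 2) - 1) - 8 * L ^ 2 := by
      rw [← hLT]
      ring
    rw [e, hlog]
    field_simp
    ring
  have h45 : 4 / Real.pi * L ^ 2 ≤ 21 / (5 * Real.pi) * L ^ 2 := by
    refine mul_le_mul_of_nonneg_right ?_ hL2.le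
    rw [div_le_div_iff₀ hπ (by positivity)]
    nlinarith [hπ]
  linarith [key, hmono, hlev, h45]

end Summit.RiemannHypothesis.RiemannHypothesis.Theorems.WeilCombBohrFejer.ArchSteffensen

end
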